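/-
Copyright (c) 2026 the pub-hodgecm-mathlib formalisation cell (harness21).  Prover seat hodgecm-mathlib-K2E3-p06 (g4), Track B «K2-LIT», engine E3, unit U4 «Keys»; deal (D61)
LINE LEAD of the open leaf (U4f-χ₁-ram-one), design D-I v2 (`K2/K2E3-p06/g4/DESIGN-M2-v2-DepthZero.K2E3-p06-g4.md`, observation (O2)), brick Z2-generic «SUPPORT OF A TYPE VECTOR»;
2026-09-04.  KERNEL module: THEOREMS ONLY (no definition, no named fact, no `sorry`, no instance, no notation).
-/
import Summits.HodgeConjecture.HodgeConjecture.Theorems.K2E3TypeVectorOfSubrep   -- ★ p857999 (V2) (this seat): `apply_eq_mul_one`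
import HarnessLib

/-!
# K2 ∕ E3 «EllipticInputs», unit U4 «Keys» — (U4f-χ₁-ram-one) brick Z2 (generic part): WHERE A TYPE VECTOR OF `Ind_H^G τ` CAN LIVE
# «a `(B, θ)`-eigen-section vanishes on every double coset `H g₀ B` on which `θ` and `τ^{g₀}` disagree, and is explicit on `H·B`»   [Roche1998 §3–§4; Casselman1995 §3.3, §6.3; BorelTits §3]

Cell hodgecm-mathlib (D-0151), FLOOR 0, Track B «K2-LIT», engine E3, crux item H413 = stmt-HodgeConjecture-24833 (route `HCCMUnconditional`, no route verbs); target BY NAME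
the OPEN leaf `…K2E3EllipticInputs.U4Keys.sig_K2E3KeysThmTwoContractingRamifiedCharOne` (U4Keys ED. 7), design D-I v2, plan step Z2 (generic).  Author K2E3-p06 (g4), line lead (D61).
`--supports stmt-HodgeConjecture-24833 --as helper`; THEOREMS ONLY.  NOT THE PAYER.

THE POINT (design v2 (O2)).  A `χ̃`-EQUIVARIANT section supported on the double coset `B w J` exists iff `(wχ)` and `χ̃` agree on `J ∩ w⁻¹Bw`; equivalently a `(J, χ̃)`-eigen-section
VANISHES at `w` as soon as ONE `j ∈ J` with `w j w⁻¹ ∈ B` has `χ̃(j) ≠ (χδ^{1∕2})(w j w⁻¹)`.  This file is the group-free core (for the tree's `Ind_H^G τ`, `τ` one-dimensional, a subgroup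
`B ≤ G` playing `J`, and an eigen-function `θ : G → ℂ` playing `χ̃`): §1 vanishing at `g₀` from one disagreeing `b`; §2 vanishing on the whole double coset `H g₀ B`; §3 the explicit values
`f(h b) = τ(h) θ(b) f(1)` on `H·B`.  BRANCH A of the leaf (`w₀ ∉ W_χ`: `χ₁ ∘ N_{E∕F} ≠ 1` on `𝒪_Eˣ`) is §2 at `g₀ = w₀` + `G = BI ⊔ Bw₀I` ★: the type vector of ★ (V2b) is `f(1)·f₁`, supported on
`B·I`, and then `(J(w₀,χ) f₁)(w₀) = vol(N̄ ∩ I)·f₁(1) ≠ 0` contradicts ★ (V1) — `i(χ)` is IRREDUCIBLE on Branch A (CM dress = step Z2A, next file).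
* §1 `toFun_eq_zero_of_eigen_of_ne` · §2 `toFun_eq_zero_on_doubleCoset` · §3 `toFun_mul_eq_of_eigen` (`f(h b) = τ(h)·θ(b)·f(1)` is `f(g b) = θ(b) f(g)` and `f(h g) = τ(h) f(g)`).
HONEST LABEL: HC_CM is proved only modulo the 7 printed citations (2 remaining named inputs: hLiu418 = stmt-HodgeConjecture-24832, h413 = stmt-HodgeConjecture-24833)
until rung 0 closes; count-neutral — this file does NOT pay the leaf; no printed citation is discharged.

## References
* [Roche1998] A. Roche, *Types and Hecke algebras for principal series representations of split reductive p-adic groups*, Ann. Sci. ÉNS (4) 31 (1998), §3–§4 (support of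
  `χ̃`-spherical vectors: `I_G(χ̃) = J W_χ J`).
* [Casselman1995] W. Casselman, *Introduction to the theory of admissible representations of `p`-adic reductive groups* (1995), §3.3, §6.3 (functions on `P\G` supported on Bruhat cells).
* [BernsteinZelevinsky1976] I. N. Bernstein, A. V. Zelevinsky, Russian Math. Surveys 31:3 (1976), §2.3.
-/

set_option autoImplicit false
-- the mandated namespace has the single-problem summit's repeated segment (`HodgeConjecture.HodgeConjecture`)
set_option linter.dupNamespace false

noncomputable section

open Literature.NumberTheory.Automorphic

namespace Summit.HodgeConjecture.HodgeConjecture.Cruxes.H413.K2E3TypeVectorSupport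

open Summit.HodgeConjecture.HodgeConjecture.Cruxes.H413 Summit.HodgeConjecture.HodgeConjecture.Cruxes.H413.K2E3TypeVectorOfSubrep

variable {G : Type*} [Group G] [TopologicalSpace G] [IsTopologicalGroup G] (H : Subgroup G) (τ : Representation ℂ ↥H ℂ)

/-! ## §1 Vanishing at a point where the two characters disagree -/

/-- **A `(B, θ)`-eigen-section vanishes at `g₀` if some `b ∈ B` with `g₀ b g₀⁻¹ ∈ H` has `θ(b) ≠ τ(g₀ b g₀⁻¹)`**: `f(g₀ b) = θ(b) f(g₀)` (eigen) and `f(g₀ b) = f((g₀bg₀⁻¹)·g₀) =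
τ(g₀bg₀⁻¹) f(g₀)` (section property ★ `SmoothInd.toFun_subgroup_mul`), so `(θ(b) − τ(g₀bg₀⁻¹))·f(g₀) = 0`.  (Roche's support criterion for `χ̃`-spherical vectors, pointwise form.)
[cite: Roche1998, §3–§4] [cite: Casselman1995, §6.3] -/
theorem toFun_eq_zero_of_eigen_of_ne (B : Subgroup G) (θ : G → ℂ) (f : Representation.SmoothInd H τ)
    (heig : ∀ b ∈ B, Representation.smoothIndRep H τ b f = θ b • f) (g₀ b : G) (hb : b ∈ B) (hbH : g₀ * b * g₀⁻¹ ∈ H)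
    (hne : θ b ≠ τ (⟨g₀ * b * g₀⁻¹, hbH⟩ : ↥H) 1) : f.toFun g₀ = 0 := by
  -- `f(g₀ b)` two ways
  have h1 : f.toFun (g₀ * b) = θ b * f.toFun g₀ := by
    have h := congrArg (fun φ : Representation.SmoothInd H τ => φ.toFun g₀) (heig b hb)
    simp only [Representation.toFun_smoothIndRep_apply, Representation.SmoothInd.toFun_smul, Pi.smul_apply, smul_eq_mul] at h
    exact h
  have h2 : f.toFun (g₀ * b) = τ (⟨g₀ * b * g₀⁻¹, hbH⟩ : ↥H) 1 * f.toFun g₀ := by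
    have h := f.toFun_subgroup_mul (⟨g₀ * b * g₀⁻¹, hbH⟩ : ↥H) g₀
    rw [apply_eq_mul_one] at h
    have hcoe : ((⟨g₀ * b * g₀⁻¹, hbH⟩ : ↥H) : G) * g₀ = g₀ * b := by
      change g₀ * b * g₀⁻¹ * g₀ = g₀ * b
      rw [inv_mul_cancel_right]
    rw [hcoe] at h
    exact h
  have h3 : (θ b - τ (⟨g₀ * b * g₀⁻¹, hbH⟩ : ↥H) 1) * f.toFun g₀ = 0 := by rw [sub_mul, ← h1, ← h2, sub_self]
  rcases mul_eq_zero.1 h3 with h | h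
  · exact absurd (sub_eq_zero.1 h) hne
  · exact h

/-! ## §2 Vanishing on the whole double coset `H g₀ B` -/

/-- **… hence on the whole double coset `H·g₀·B`**: `f(h g₀ b′) = τ(h)·θ(b′)·f(g₀) = 0`. [cite: Roche1998, §3–§4] [cite: Casselman1995, §3.3, §6.3] -/
theorem toFun_eq_zero_on_doubleCoset (B : Subgroup G) (θ : G → ℂ) (f : Representation.SmoothInd H τ)
    (heig : ∀ b ∈ B, Representation.smoothIndRep H τ b f = θ b • f) (g₀ b : G) (hb : b ∈ B) (hbH : g₀ * b * g₀⁻¹ ∈ H)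
    (hne : θ b ≠ τ (⟨g₀ * b * g₀⁻¹, hbH⟩ : ↥H) 1) (h : G) (hh : h ∈ H) (b' : G) (hb' : b' ∈ B) : f.toFun (h * g₀ * b') = 0 := by
  have h0 := toFun_eq_zero_of_eigen_of_ne H τ B θ f heig g₀ b hb hbH hne
  -- `f(h g₀ b′) = τ(h) f(g₀ b′) = τ(h) θ(b′) f(g₀)`
  have h1 : f.toFun (g₀ * b') = θ b' * f.toFun g₀ := by
    have h := congrArg (fun φ : Representation.SmoothInd H τ => φ.toFun g₀) (heig b' hb')
    simp only [Representation.toFun_smoothIndRep_apply, Representation.SmoothInd.toFun_smul, Pi.smul_apply, smul_eq_mul] at h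
    exact h
  have h2 := f.toFun_subgroup_mul (⟨h, hh⟩ : ↥H) (g₀ * b')
  rw [apply_eq_mul_one, h1, h0, mul_zero, mul_zero] at h2
  rw [mul_assoc]
  exact h2

/-! ## §3 Explicit values on `H·B` -/

/-- **On `H·B` a `(B, θ)`-eigen-section is explicit: `f(h b) = τ(h)·θ(b)·f(1)`.**  With §2 this determines `f` completely whenever `G = H·B ⊔ H g₀ B` and the characters disagree on
`H g₀ B` (Branch A at depth zero: `G = BI ⊔ Bw₀I`, `f = f(1)·f₁`). [cite: Roche1998, §3–§4] [cite: BernsteinZelevinsky1976, §2.3] -/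
theorem toFun_mul_eq_of_eigen (B : Subgroup G) (θ : G → ℂ) (f : Representation.SmoothInd H τ)
    (heig : ∀ b ∈ B, Representation.smoothIndRep H τ b f = θ b • f) (h : G) (hh : h ∈ H) (b : G) (hb : b ∈ B) :
    f.toFun (h * b) = τ (⟨h, hh⟩ : ↥H) 1 * θ b * f.toFun 1 := by
  have h1 : f.toFun (1 * b) = θ b * f.toFun 1 := by
    have e := congrArg (fun φ : Representation.SmoothInd H τ => φ.toFun 1) (heig b hb)
    simp only [Representation.toFun_smoothIndRep_apply, Representation.SmoothInd.toFun_smul, Pi.smul_apply, smul_eq_mul] at e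
    exact e
  rw [one_mul] at h1
  have h2 := f.toFun_subgroup_mul (⟨h, hh⟩ : ↥H) b
  rw [apply_eq_mul_one, h1, ← mul_assoc] at h2
  exact h2

end Summit.HodgeConjecture.HodgeConjecture.Cruxes.H413.K2E3TypeVectorSupport

end
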